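import Mathlib
import Literature.Barriers.CriticalPhenomena.LongRangeDiscontinuityProofs
import HarnessLib

/-!
# A Dini-type comparison lemma with an `L¹` rate (tool for
  `RossbyDichotomy.StretchingAtMaxCriterion`, item stmt-NavierStokesRegularity-2923)

**Lemma (`StretchingAtMax.bounded_of_touching`).** Let `a < T`, let `M ≥ 0` be continuous on
`[a, T)`, `g ∈ L¹(a, T)`, and suppose that at every `t ∈ (a, T)` the function `M` is touched from
below by a function `φ` differentiable at `t` — `φ t = M t`, `φ ≤ M` on `[a, t]` — with
`φ' (t) ≤ g t · M t`. Then `M` is bounded on `[a, T)`.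

This is the "`D⁻M ≤ g M` with `g` merely integrable ⇒ Grönwall" step of envelope / Danskin arguments
(`M(t) = maxₓ F(t, x)`, `φ = F(·, x*)` for a maximiser `x*` at time `t`). Since `g` is only
integrable, `t ↦ exp ∫ g` need not be differentiable and the inequality only controls a one-sided
Dini derivative; the classical remedy (Saks; Rudin, *Real and Complex Analysis*, Thm. 7.21 via the
Vitali–Carathéodory theorem) is used: take a lower semicontinuous integrable majorant `G > g⁺`
(Mathlib `MeasureTheory.exists_lt_lowerSemicontinuous_integral_gt_nnreal`; the elementary
`x - x² ≤ 1 - e^{-x}` is the tree's `Literature.Barriers.CriticalPhenomena.sub_sq_le_one_sub_exp_neg`), put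
`B(t) = (M(a) + 1) exp ∫ₐᵗ G`, and show `M < B` on `[a, T)` by a first-crossing argument: at the
first time `τ` with `M τ = B τ`, the left increments satisfy
`B τ − B(τ−h) ≥ B τ (r h − r² h²)` for any `g τ < r < G τ` (lower semicontinuity of `G` at `τ`),
while `M τ − M(τ−h) ≤ φ τ − φ(τ−h) ≤ (g τ · M τ + ε) h` — impossible for small `h`.

HONEST FRAMING: an elementary real-analysis lemma; nothing here is specific to fluids.
-/

noncomputable section

set_option linter.dupNamespace false

namespace Summit.NavierStokesRegularity.NavierStokesRegularity.Theorems

namespace StretchingAtMax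

open MeasureTheory Set Filter Topology
open scoped NNReal ENNReal

/-- **Vitali–Carathéodory majorant, packaged**: an `L¹(a, T)` function `g` has a lower
semicontinuous majorant `G : ℝ → ℝ≥0∞` with `ofReal (g t) < G t` on `(a, T)`, `G < ∞` a.e. and
`G.toReal ∈ L¹(ℝ)`. [folklore] -/
theorem exists_lsc_majorant {g : ℝ → ℝ} {a T : ℝ} (hg : IntegrableOn g (Ioo a T)) :
    ∃ G : ℝ → ℝ≥0∞, LowerSemicontinuous G ∧ (∀ t ∈ Ioo a T, ENNReal.ofReal (g t) < G t) ∧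
      (∀ᵐ t, G t < ⊤) ∧ Integrable (fun t => (G t).toReal) := by
  set F : ℝ → ℝ≥0 := fun t => ((Ioo a T).indicator (fun s => max (g s) 0) t).toNNReal with hF
  have hnn : ∀ t, 0 ≤ (Ioo a T).indicator (fun s => max (g s) 0) t := fun t => by
    by_cases ht : t ∈ Ioo a T
    · rw [indicator_of_mem ht]; exact le_max_right _ _
    · rw [indicator_of_notMem ht]
  have hFint : Integrable (fun t => (F t : ℝ)) := by
    have h1 : Integrable ((Ioo a T).indicator fun s => max (g s) 0) :=
      (integrable_indicator_iff measurableSet_Ioo).2 hg.pos_part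
    refine h1.congr (Eventually.of_forall fun t => ?_)
    simp only [hF, Real.coe_toNNReal _ (hnn t)]
  obtain ⟨G, hFG, hlsc, hfin, hint, -⟩ :=
    exists_lt_lowerSemicontinuous_integral_gt_nnreal F hFint one_pos
  refine ⟨G, hlsc, fun t ht => ?_, hfin, hint⟩
  have h1 : ENNReal.ofReal (g t) ≤ (F t : ℝ≥0∞) := by
    rw [ENNReal.ofReal, ENNReal.coe_le_coe, hF]
    dsimp only
    rw [indicator_of_mem ht]
    exact Real.toNNReal_le_toNNReal (le_max_left _ _)
  exact h1.trans_lt (hFG t)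

/-- **Dini comparison with an `L¹` rate.** If `M ≥ 0` is continuous on `[a, T)` (`a < T`),
`g ∈ L¹(a, T)`, and at every `t ∈ (a, T)` some `φ` with `φ t = M t`, `φ ≤ M` on `[a, t]` is
differentiable at `t` with `φ'(t) ≤ g t · M t`, then `M` is bounded on `[a, T)`.
[cite: Rudin1987, Thm. 7.21 (Vitali–Carathéodory step)] -/
theorem bounded_of_touching {M g : ℝ → ℝ} {a T : ℝ} (haT : a < T)
    (hM : ContinuousOn M (Ico a T)) (hM0 : ∀ t ∈ Ico a T, 0 ≤ M t)
    (hg : IntegrableOn g (Ioo a T))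
    (htouch : ∀ t ∈ Ioo a T, ∃ φ : ℝ → ℝ, ∃ d : ℝ,
      φ t = M t ∧ (∀ s ∈ Icc a t, φ s ≤ M s) ∧ HasDerivAt φ d t ∧ d ≤ g t * M t) :
    ∃ K : ℝ, ∀ t ∈ Ico a T, M t ≤ K := by
  obtain ⟨G, hlsc, hgG, hfin, hint⟩ := exists_lsc_majorant hg
  have hGi : ∀ x y, IntervalIntegrable (fun s => (G s).toReal) volume x y :=
    fun x y => hint.intervalIntegrable
  set I : ℝ → ℝ := fun t => ∫ s in a..t, (G s).toReal with hI
  have hIcont : Continuous I := intervalIntegral.continuous_primitive hGi a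
  set Itot : ℝ := ∫ s, (G s).toReal with hItot
  have hI_le : ∀ t, a ≤ t → I t ≤ Itot := by
    intro t ht
    simp only [hI]
    rw [intervalIntegral.integral_of_le ht]
    exact setIntegral_le_integral hint (Eventually.of_forall fun s => ENNReal.toReal_nonneg)
  have hMa : 0 ≤ M a := hM0 a ⟨le_rfl, haT⟩
  set B : ℝ → ℝ := fun t => (M a + 1) * Real.exp (I t) with hB
  have hBpos : ∀ t, 0 < B t := fun t => mul_pos (by linarith) (Real.exp_pos _)
  have hBcont : Continuous B := continuous_const.mul (Real.continuous_exp.comp hIcont)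
  have hBa : B a = M a + 1 := by simp [hB, hI]
  -- the claim `M < B` on `[a, T)`
  have hclaim : ∀ t ∈ Ico a T, M t < B t := by
    by_contra H
    push Not at H
    obtain ⟨t₁, ht₁, ht₁le⟩ := H
    set A : Set ℝ := Icc a t₁ ∩ (fun t => B t - M t) ⁻¹' Iic 0 with hA
    have hIcc_sub : Icc a t₁ ⊆ Ico a T := fun s hs => ⟨hs.1, hs.2.trans_lt ht₁.2⟩
    have hcontBM : ContinuousOn (fun t => B t - M t) (Icc a t₁) :=
      hBcont.continuousOn.sub (hM.mono hIcc_sub)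
    have hAclosed : IsClosed A :=
      hcontBM.preimage_isClosed_of_isClosed isClosed_Icc isClosed_Iic
    have ht₁A : t₁ ∈ A := ⟨⟨ht₁.1, le_rfl⟩, sub_nonpos.2 ht₁le⟩
    have hAne : A.Nonempty := ⟨t₁, ht₁A⟩
    have hAbdd : BddBelow A := ⟨a, fun s hs => hs.1.1⟩
    set τ : ℝ := sInf A with hτ
    have hτA : τ ∈ A := hAclosed.csInf_mem hAne hAbdd
    have haτ : a ≤ τ := hτA.1.1
    have hτt₁ : τ ≤ t₁ := hτA.1.2
    have hτT : τ < T := hτt₁.trans_lt ht₁.2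
    have hBMτ : B τ ≤ M τ := sub_nonpos.1 hτA.2
    have hτa : a < τ := by
      rcases haτ.eq_or_lt with h | h
      · exfalso
        rw [← h, hBa] at hBMτ
        linarith
      · exact h
    have hbelow : ∀ s ∈ Ico a τ, M s < B s := by
      intro s hs
      by_contra hn
      push Not at hn
      have hsA : s ∈ A := ⟨⟨hs.1, hs.2.le.trans hτt₁⟩, sub_nonpos.2 hn⟩
      exact absurd (csInf_le hAbdd hsA) (not_le.2 hs.2)
    -- `M τ = B τ` by continuity from the left
    have hMBτ : M τ = B τ := by
      refine le_antisymm ?_ hBMτ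
      have hcw : ContinuousWithinAt (fun t => B t - M t) (Ico a τ) τ :=
        (hcontBM τ hτA.1).mono fun s hs => ⟨hs.1, hs.2.le.trans hτt₁⟩
      haveI hne : (𝓝[Ico a τ] τ).NeBot := by
        refine mem_closure_iff_nhdsWithin_neBot.1 ?_
        rw [closure_Ico hτa.ne]
        exact ⟨haτ, le_rfl⟩
      have hev : ∀ᶠ s in 𝓝[Ico a τ] τ, 0 ≤ B s - M s :=
        eventually_nhdsWithin_of_forall fun s hs => (sub_pos.2 (hbelow s hs)).le
      have h0 : 0 ≤ B τ - M τ := ge_of_tendsto hcw.tendsto hev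
      linarith
    -- touching function at `τ`
    obtain ⟨φ, d, hφτ, hφle, hφd, hd⟩ := htouch τ ⟨hτa, hτT⟩
    -- a real strictly between `g τ` and `G τ`
    obtain ⟨r, hgr, hrG⟩ := ENNReal.lt_iff_exists_nnreal_btwn.1 (hgG τ ⟨hτa, hτT⟩)
    have hgr' : g τ < (r : ℝ) := by
      have h1 := ENNReal.toReal_strict_mono ENNReal.coe_ne_top hgr
      rw [ENNReal.toReal_ofReal', ENNReal.coe_toReal] at h1
      exact (le_max_left _ _).trans_lt h1
    have hr0 : (0 : ℝ) ≤ r := r.2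
    -- a neighbourhood of `τ` where `G > r`
    obtain ⟨δ₁, hδ₁, hδ₁G⟩ := Metric.eventually_nhds_iff.1 (hlsc τ (r : ℝ≥0∞) hrG)
    -- left increments of `I`: `I τ - I (τ - h) ≥ r h`
    have hIinc : ∀ h, 0 < h → h < δ₁ → (r : ℝ) * h ≤ I τ - I (τ - h) := by
      intro h hh hhδ
      have hsplit : I τ - I (τ - h) = ∫ s in (τ - h)..τ, (G s).toReal := by
        simp only [hI]
        rw [intervalIntegral.integral_interval_sub_left (hGi _ _) (hGi _ _)]
      rw [hsplit]
      have hle : ∫ _ in (τ - h)..τ, (r : ℝ) ≤ ∫ s in (τ - h)..τ, (G s).toReal := by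
        refine intervalIntegral.integral_mono_ae_restrict (by linarith) intervalIntegrable_const
          (hGi _ _) ?_
        filter_upwards [ae_restrict_mem measurableSet_Icc, ae_restrict_of_ae hfin] with s hs hsfin
        have hsG : (r : ℝ≥0∞) < G s := hδ₁G (by
          rw [Real.dist_eq, abs_lt]
          constructor <;> linarith [hs.1, hs.2])
        have := ENNReal.toReal_mono hsfin.ne hsG.le
        rwa [ENNReal.coe_toReal] at this
      have hconst : ∫ _ in (τ - h)..τ, (r : ℝ) = r * h := by
        rw [intervalIntegral.integral_const, smul_eq_mul]
        ring
      linarith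
    -- left increments of `B`
    have hBinc : ∀ h, 0 < h → h < δ₁ → B τ * (r * h - (r * h) ^ 2) ≤ B τ - B (τ - h) := by
      intro h hh hhδ
      have hx : (r : ℝ) * h ≤ I τ - I (τ - h) := hIinc h hh hhδ
      have hrh : 0 ≤ (r : ℝ) * h := mul_nonneg hr0 hh.le
      have h1 : (r : ℝ) * h - (r * h) ^ 2 ≤ 1 - Real.exp (-(r * h)) :=
        Literature.Barriers.CriticalPhenomena.sub_sq_le_one_sub_exp_neg hrh
      have h2 : Real.exp (-(I τ - I (τ - h))) ≤ Real.exp (-(r * h)) :=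
        Real.exp_le_exp.2 (by linarith)
      have hBeq : B (τ - h) = B τ * Real.exp (-(I τ - I (τ - h))) := by
        simp only [hB]
        rw [mul_assoc, ← Real.exp_add]
        congr 2
        ring
      rw [hBeq]
      have hB0 := (hBpos τ).le
      nlinarith [mul_le_mul_of_nonneg_left h1 hB0, mul_le_mul_of_nonneg_left h2 hB0]
    -- the derivative of `φ` at `τ`: `φ τ - φ (τ - h) ≤ (d + ε) h` for small `h`
    set ε : ℝ := ((r : ℝ) - g τ) * B τ / 2 with hε
    have hεpos : 0 < ε := by
      have : 0 < (r : ℝ) - g τ := by linarith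
      positivity
    obtain ⟨δ₂, hδ₂, hδ₂φ⟩ :=
      Metric.eventually_nhds_iff.1 ((hasDerivAt_iff_isLittleO.1 hφd).def hεpos)
    -- choose `h`
    set h : ℝ := min (min δ₁ δ₂) (min (τ - a) (ε / ((r : ℝ) ^ 2 * B τ + 1))) / 2 with hh
    have hq : 0 < (r : ℝ) ^ 2 * B τ + 1 := by nlinarith [hBpos τ, sq_nonneg (r : ℝ)]
    have hhpos : 0 < h := by
      have : 0 < ε / ((r : ℝ) ^ 2 * B τ + 1) := div_pos hεpos hq
      have : 0 < τ - a := by linarith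
      positivity
    have hmin_le₁ : h < δ₁ := by
      have : min (min δ₁ δ₂) (min (τ - a) (ε / ((r : ℝ) ^ 2 * B τ + 1))) ≤ δ₁ :=
        (min_le_left _ _).trans (min_le_left _ _)
      rw [hh]; linarith
    have hmin_le₂ : h < δ₂ := by
      have : min (min δ₁ δ₂) (min (τ - a) (ε / ((r : ℝ) ^ 2 * B τ + 1))) ≤ δ₂ :=
        (min_le_left _ _).trans (min_le_right _ _)
      rw [hh]; linarith
    have hmin_le₃ : h < τ - a := by
      have : min (min δ₁ δ₂) (min (τ - a) (ε / ((r : ℝ) ^ 2 * B τ + 1))) ≤ τ - a :=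
        (min_le_right _ _).trans (min_le_left _ _)
      rw [hh]; linarith
    have hmin_le₄ : h < ε / ((r : ℝ) ^ 2 * B τ + 1) := by
      have : min (min δ₁ δ₂) (min (τ - a) (ε / ((r : ℝ) ^ 2 * B τ + 1))) ≤
          ε / ((r : ℝ) ^ 2 * B τ + 1) := (min_le_right _ _).trans (min_le_right _ _)
      rw [hh]; linarith
    have hsmall : (r : ℝ) ^ 2 * B τ * h < ε := by
      have h1 : (r : ℝ) ^ 2 * B τ * h ≤ ((r : ℝ) ^ 2 * B τ + 1) * h :=
        mul_le_mul_of_nonneg_right (by linarith) hhpos.le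
      have h2 : ((r : ℝ) ^ 2 * B τ + 1) * h < ε := by
        have := (lt_div_iff₀ hq).1 hmin_le₄
        linarith
      linarith
    -- the slope bound for `φ`
    have hφinc : φ τ - φ (τ - h) ≤ (d + ε) * h := by
      have h1 := hδ₂φ (y := τ - h) (by rw [Real.dist_eq]; rw [abs_lt]; constructor <;> linarith)
      rw [Real.norm_eq_abs, Real.norm_eq_abs, show τ - h - τ = -h by ring, abs_neg,
        abs_of_pos hhpos] at h1
      have h2 := (abs_le.1 h1).1
      simp only [smul_eq_mul] at h2
      linarith
    -- compare the increments
    have hτh : τ - h ∈ Ico a τ := ⟨by linarith, by linarith⟩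
    have hM1 : M (τ - h) < B (τ - h) := hbelow _ hτh
    have hφ1 : φ (τ - h) ≤ M (τ - h) := hφle _ ⟨by linarith, by linarith⟩
    have hup : B τ - B (τ - h) < (g τ * B τ + ε) * h := by
      have h1 : B τ - B (τ - h) < φ τ - φ (τ - h) := by rw [hφτ, hMBτ]; linarith
      have h2 : (d + ε) * h ≤ (g τ * M τ + ε) * h :=
        mul_le_mul_of_nonneg_right (by linarith) hhpos.le
      rw [hMBτ] at h2
      linarith
    have hlow : ((r : ℝ) * B τ - ε) * h < B τ - B (τ - h) := by
      have h1 := hBinc h hhpos hmin_le₁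
      have h2 : ((r : ℝ) * B τ - ε) * h < B τ * (r * h - (r * h) ^ 2) := by
        have : B τ * (r * h - (r * h) ^ 2) = ((r : ℝ) * B τ - (r : ℝ) ^ 2 * B τ * h) * h := by
          ring
        rw [this]
        exact mul_lt_mul_of_pos_right (by linarith) hhpos
      linarith
    have hfin' : ((r : ℝ) * B τ - ε) * h < (g τ * B τ + ε) * h := hlow.trans hup
    have hfin'' : (r : ℝ) * B τ - ε < g τ * B τ + ε := lt_of_mul_lt_mul_right hfin' hhpos.le
    have : ((r : ℝ) - g τ) * B τ < 2 * ε := by linarith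
    rw [hε] at this
    linarith
  exact ⟨(M a + 1) * Real.exp Itot, fun t ht => (hclaim t ht).le.trans
    (mul_le_mul_of_nonneg_left (Real.exp_le_exp.2 (hI_le t ht.1)) (by linarith))⟩

end StretchingAtMax

end Summit.NavierStokesRegularity.NavierStokesRegularity.Theorems

end
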